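import Summits.BirchSwinnertonDyer.BirchSwinnertonDyer.Theorems.CyclotomicUntwistPSLocalThreeTorsionII
import Summits.BirchSwinnertonDyer.Rank1Residual.O6.KuriharaPollackWildThree
import HarnessLib

/-!
# Kurihara–Pollack hypothesis (H3) at the wild prime `3` on the principal-series rows, in Kraus currency:
# `W(ℚ₃)[3] = 0 ⟺ ¬ (v₃Δ_min ≤ 6 ∧ c₆(W_ℤ)/3^{v₃c₆} ≡ 1 (mod 3))`

Cell `pub/bsd-wall` (D-0145 line `route-BirchSwinnertonDyer-CyclotomicUntwist`), seat `bsd-line-cycu-p2`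
(prover seat 2/3, gen 3), helper toward K1 `PSRankOneLowerHalfAtThree` (stmt-BirchSwinnertonDyer-21580) and
K2 `PSRankOneUpperHalfAtThree` (stmt-21581); by-name reading for the O6 lane's T-O6-G15 "Kurihara–Pollack at a
wild 3" (`O6/KuriharaPollackWildThree.lean`: `NoRationalThreeTorsionOverQ3 W`, the (H3) conjunct of
`KPHypothesesThree W`). THEOREMS ONLY (no definition, no named fact, no `sorry`); BSD is not proved by this
file and no crux is.

On the cyclic wild cell at `3` (`ClassO6 W 3`, `v = v₃Δ_min` even; the route's PS rows and their
Frobenius-inverted twins) this seat's LAW L-t3 (`not_noLocalThreeTorsionAt_three_iff_of_psRow`, p605839)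
decides (H3): it HOLDS iff `v ≥ 10` (Kodaira `IV*`, `II*`) or `c₆(W_ℤ)/3^{v₃c₆} ≡ 2 (mod 3)`; equivalently it
FAILS exactly on the `II`/`IV` rows with `c₆/3^{v₃c₆} ≡ 1 (mod 3)` (on the `IV` rows: exactly when `c₃ = 3`,
`exists_three_torsion_iff_localTamagawaNumber_eq_three_of_kodairaIV`).
References: R. Pollack, On the p-adic L-function of a modular form at a supersingular prime, Duke Math. J.
118 (2003) / Compos. Math. (2005), Thm. 1.1 (hypotheses) [Pollack2005]; J.-P. Serre, Invent. Math. 15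
(1972), §1.11 [Serre1972].
-/

set_option autoImplicit false
-- single-conjunct summit: `Summit.BirchSwinnertonDyer.BirchSwinnertonDyer.…` repeats the name by design
set_option linter.dupNamespace false

noncomputable section

open scoped Classical

open WeierstrassCurve IsDedekindDomain Rat.HeightOneSpectrum Literature.NumberTheory.EllipticCurves
  Literature.NumberTheory.EllipticCurves.Rank1Residual Literature.NumberTheory.DiophantineGeometry
  Summit.BirchSwinnertonDyer.Rank1Residual.Additive Summit.BirchSwinnertonDyer.Rank1Residual.O5
  Summit.BirchSwinnertonDyer.Rank1Residual.O6

namespace Summit.BirchSwinnertonDyer.BirchSwinnertonDyer.Theorems.PSLocalThreeTorsion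

section KP

variable (W : WeierstrassCurve ℚ) [W.IsElliptic]

/-- (H3) of T-O6-G15 IS the O5 census predicate: `NoRationalThreeTorsionOverQ3 W ↔ NoLocalThreeTorsionAt W 3`
(for elliptic `W`; E111 `noLocalThreeTorsionAt_iff_forall_three_nsmul`). [cite: SilvermanAEC2009, Exercise 3.7 (d)] -/
theorem noRationalThreeTorsionOverQ3_iff_noLocalThreeTorsionAt :
    NoRationalThreeTorsionOverQ3 W ↔ NoLocalThreeTorsionAt W 3 := by
  unfold NoRationalThreeTorsionOverQ3
  exact (noLocalThreeTorsionAt_iff_forall_three_nsmul W 3).symm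

variable [W.IsGloballyMinimal]

/-- **(H3) on the cyclic wild cell, in Kraus currency**: for `ClassO6 W 3` with `v₃Δ_min` even,
`W(ℚ₃)[3] = 0 ⟺ ¬ (v₃Δ_min ≤ 6 ∧ c₆(W_ℤ)/3^{v₃c₆} % 3 = 1)`. [cite: Serre1972, §1.11] [cite: Pollack2005, Thm. 1.1 (hypotheses)] -/
theorem noRationalThreeTorsionOverQ3_iff_of_psRow (hO6 : ClassO6 W 3)
    (hev : Even (padicValInt 3 W.minimalDiscriminantInt)) :
    NoRationalThreeTorsionOverQ3 W ↔
      ¬ (padicValInt 3 W.minimalDiscriminantInt ≤ 6 ∧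
          (integralModelInt W).c₆ / 3 ^ padicValInt 3 (integralModelInt W).c₆ % 3 = 1) := by
  rw [noRationalThreeTorsionOverQ3_iff_noLocalThreeTorsionAt, ← not_noLocalThreeTorsionAt_three_iff_of_psRow W hO6 hev,
    not_not]

/-- **(H3) HOLDS on every `IV*` / `II*` row** (`v₃Δ_min ≥ 10`) of the cyclic wild cell.
[cite: SilvermanATAEC1994, IV.9.4 Steps 8, 10] -/
theorem noRationalThreeTorsionOverQ3_of_psRow_of_ten_le (hO6 : ClassO6 W 3)
    (hev : Even (padicValInt 3 W.minimalDiscriminantInt)) (h10 : 10 ≤ padicValInt 3 W.minimalDiscriminantInt) :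
    NoRationalThreeTorsionOverQ3 W := by
  rw [noRationalThreeTorsionOverQ3_iff_of_psRow W hO6 hev]
  omega

/-- **(H3) on the `II` / `IV` rows** (`v₃Δ_min ≤ 6`): it holds iff `c₆(W_ℤ)/3^{v₃c₆} % 3 ≠ 1` (i.e. `= 2`: the
stable line is ETM, not ET1). [cite: Serre1972, §1.11] -/
theorem noRationalThreeTorsionOverQ3_iff_of_psRow_of_le_six (hO6 : ClassO6 W 3)
    (hev : Even (padicValInt 3 W.minimalDiscriminantInt)) (hle : padicValInt 3 W.minimalDiscriminantInt ≤ 6) :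
    NoRationalThreeTorsionOverQ3 W ↔
      (integralModelInt W).c₆ / 3 ^ padicValInt 3 (integralModelInt W).c₆ % 3 ≠ 1 := by
  rw [noRationalThreeTorsionOverQ3_iff_of_psRow W hO6 hev]
  exact ⟨fun h h1 ↦ h ⟨hle, h1⟩, fun h h1 ↦ h h1.2⟩

/-- **(H3) vs the Tamagawa hypothesis (H2 at `ℓ = 3` is NOT part of KP, but compare)**: on the Kodaira-`IV`
rows (`v₃Δ_min = 6`) (H3) holds iff `c₃ ≠ 3` (iff `c₃ = 1`), by LAW L-c3 + LAW L-t3; on the `IV*` rows (H3)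
holds although `c₃ = 3` occurs. [cite: SilvermanATAEC1994, IV.9.4 Step 5] -/
theorem noRationalThreeTorsionOverQ3_iff_localTamagawaNumber_ne_three_of_kodairaIV
    (hK : W.kodairaSymbolAt (placeOf 3) = .IV) (hv : padicValInt 3 W.minimalDiscriminantInt = 6) :
    NoRationalThreeTorsionOverQ3 W ↔ (W.baseChange ℚ_[3]).localTamagawaNumber ℤ_[3] ≠ 3 := by
  rw [noRationalThreeTorsionOverQ3_iff_noLocalThreeTorsionAt, Ne,
    PSTamagawaThree.localTamagawaNumber_three_eq_three_iff_of_kodairaIV W hK hv,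
    ← not_noLocalThreeTorsionAt_three_iff_c₆_of_kodairaIV W hK hv, not_not]

end KP

end Summit.BirchSwinnertonDyer.BirchSwinnertonDyer.Theorems.PSLocalThreeTorsion

end
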